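import Summits.RiemannHypothesis.RiemannHypothesis.Theorems.AsymptoticCriticalLine.Negative.KnownEnd
import Literature.Barriers.RiemannHypothesis.LindelofBacklund
import Literature.NumberTheory.LFunctions.ZeroCounting

/-!
# `AsymptoticCriticalLine` sits above the Lindelöf and Density hypotheses (negative lemmas, cycle 3)

Kill propagation DOWNWARDS for the crux `AsymptoticCriticalLine` (stmt-RiemannHypothesis-2063,
route RuelleBand): the crux makes every window count `N(σ, T+1) − N(σ, T)`, `σ > 1/2`, vanish
eventually, hence Backlund's zero condition holds (`backlundZeroCondition_of_acl`, PROVED), hence —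
through the catalogued named fact `Titchmarsh1986_thm13_5` (barrier `LindelofBacklund`) — the
Lindelöf hypothesis (`lindelof_of_acl`) and all critical moments `O(T^ε)` (`Titchmarsh1986_thm13_2`);
and the Density hypothesis outright (`densityHypothesis_of_acl`, PROVED from the crux and the
tree's Ingham theorem at `σ = 1/2`). So `RH ⟹ #5 ⟹ crux ⟹ {LH (mod Thm 13.5), DH}`: a kill of the
crux is implied by `¬LH` or `¬DH` and implies `¬RH` (`Ladder.not_riemannHypothesis_of_not_acl`).
-/

noncomputable section

set_option linter.dupNamespace false

namespace Summit.RiemannHypothesis.RiemannHypothesis.Theorems.AsymptoticCriticalLine.Negative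

open Complex Set Filter Asymptotics
open Summit.RiemannHypothesis.RiemannHypothesis.Theses.RuelleBand (AsymptoticCriticalLine)
open Literature.NumberTheory.LFunctions (zetaZeroCountRe zetaZeroBox LindelofHypothesis
  DensityHypothesis zeroDensity_ingham_holds)
open Literature.Barriers.RiemannHypothesis (BacklundZeroCondition Titchmarsh1986_thm13_5
  Titchmarsh1986_thm13_2 criticalMoment)

/-- Under the crux the boxes of zeros to the right of any line `σ > 1/2` stop growing:
`zetaZeroBox σ (T+1) = zetaZeroBox σ T` for `T ≥ T₀(σ)`. [folklore] -/
theorem zetaZeroBox_succ_eq_of_acl (hacl : AsymptoticCriticalLine) {σ : ℝ} (hσ : 1 / 2 < σ) :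
    ∃ T₀ : ℝ, ∀ T : ℝ, T₀ ≤ T → zetaZeroBox σ (T + 1) = zetaZeroBox σ T := by
  obtain ⟨T₀, hT₀⟩ := eventually_zeroFree_of_bandSet_finite (ε := σ - 1 / 2) (by linarith)
    (acl_iff_bandSet.1 hacl _ (by linarith))
  refine ⟨T₀, fun T hT => Set.Subset.antisymm ?_ ?_⟩
  · rintro ρ ⟨hz, hσρ, h1, him0, himT⟩
    refine ⟨hz, hσρ, h1, him0, ?_⟩
    by_contra hle
    refine hT₀ ρ (by linarith) ?_ hz
    rw [abs_of_pos him0]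
    linarith [not_le.1 hle]
  · rintro ρ ⟨hz, hσρ, h1, him0, himT⟩
    exact ⟨hz, hσρ, h1, him0, by linarith⟩

/-- … hence every window count `N(σ, T+1) − N(σ, T)`, `σ > 1/2`, is eventually ZERO. [folklore] -/
theorem windowCount_eventually_zero_of_acl (hacl : AsymptoticCriticalLine) {σ : ℝ} (hσ : 1 / 2 < σ) :
    ∀ᶠ T : ℝ in atTop, ((zetaZeroCountRe σ (T + 1) : ℝ) - zetaZeroCountRe σ T) = 0 := by
  obtain ⟨T₀, hT₀⟩ := zetaZeroBox_succ_eq_of_acl hacl hσ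
  filter_upwards [eventually_ge_atTop T₀] with T hT
  simp only [zetaZeroCountRe, hT₀ T hT, sub_self]

/-- BACKLUND'S ZERO CONDITION follows from the crux (unconditionally): `0 = o(log T)`. The crux is
the endpoint "0 per window" of the scale whose point "o(log T) per window" is Lindelöf
(Titchmarsh Thm 13.5) and whose known point is "O(log T) per window" (Titchmarsh Thm 9.2).
[folklore] -/
theorem backlundZeroCondition_of_acl (hacl : AsymptoticCriticalLine) : BacklundZeroCondition := by
  intro σ hσ
  refine (isLittleO_zero (fun T : ℝ => Real.log T) atTop).congr' ?_ EventuallyEq.rfl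
  filter_upwards [windowCount_eventually_zero_of_acl hacl hσ] with T hT
  exact hT.symm

/-- KILL PROPAGATION DOWN TO LINDELÖF (modulo the catalogued named fact `Titchmarsh1986_thm13_5`,
barrier `LindelofBacklund`): the crux implies the Lindelöf hypothesis. [folklore] -/
theorem lindelof_of_acl (h : Titchmarsh1986_thm13_5) (hacl : AsymptoticCriticalLine) :
    LindelofHypothesis :=
  h.2 (backlundZeroCondition_of_acl hacl)

/-- Contrapositive: an `Ω`-result `ζ(1/2 + it) = Ω(t^c)`, `c > 0` (`¬LH`) would kill the crux.
None is known or expected (record `μ(1/2) ≤ 13/84`, tree `bourgain_subconvexity`). [folklore] -/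
theorem not_acl_of_not_lindelof (h : Titchmarsh1986_thm13_5) (hLH : ¬ LindelofHypothesis) :
    ¬ AsymptoticCriticalLine :=
  fun hacl => hLH (lindelof_of_acl h hacl)

/-- … and every critical moment is `O(T^ε)` under the crux (modulo Titchmarsh Thms 13.5, 13.2):
a moment lower bound `∫₁^T |ζ(1/2+it)|^{2k} dt ≫ T^{1+c}` would kill it. The conjectured
`≍ T (log T)^{k²}` is consistent. [folklore] -/
theorem criticalMoment_isBigO_of_acl (h5 : Titchmarsh1986_thm13_5) (h2 : Titchmarsh1986_thm13_2)
    (hacl : AsymptoticCriticalLine) {k : ℕ} (hk : 1 ≤ k) {ε : ℝ} (hε : 0 < ε) :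
    criticalMoment k =O[atTop] fun T : ℝ => T ^ ε :=
  h2.1 (lindelof_of_acl h5 hacl) k hk ε hε

/-- THE DENSITY HYPOTHESIS follows from the crux UNCONDITIONALLY (no named fact): for `σ > 1/2`
the counts are bounded (`countRe_bounded_of_acl`), and at `σ = 1/2` the bound `N(T) = O(T^{1+ε})`
is the tree's Ingham theorem `zeroDensity_ingham_holds`. DH is open below `σ = 25/32`
(Bourgain 2000); so `¬DH` would kill the crux as well. [folklore] -/
theorem densityHypothesis_of_acl (hacl : AsymptoticCriticalLine) : DensityHypothesis := by
  intro ε hε σ hσ hσ1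
  rcases hσ.eq_or_lt with h | h
  · subst h
    have hI := zeroDensity_ingham_holds ε hε (1 / 2) le_rfl (by norm_num)
    have he : (3 / (2 - 1 / 2) * (1 - 1 / 2) + ε : ℝ) = 2 * (1 - 1 / 2) + ε := by norm_num
    exact hI.congr_right fun T => by rw [he]
  · obtain ⟨C, hC⟩ := countRe_bounded_of_acl hacl (ε := σ - 1 / 2) (by linarith)
    have hx : 0 ≤ 2 * (1 - σ) + ε := by linarith
    have hσ' : 1 / 2 + (σ - 1 / 2) = σ := by ring
    refine IsBigO.of_bound (C : ℝ) ?_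
    filter_upwards [eventually_ge_atTop (1 : ℝ)] with T hT
    have h1 : (1 : ℝ) ≤ T ^ (2 * (1 - σ) + ε) := Real.one_le_rpow hT hx
    rw [Real.norm_natCast, Real.norm_of_nonneg (zero_le_one.trans h1)]
    have hCT : (zetaZeroCountRe σ T : ℝ) ≤ C := by
      have := hC T
      rw [hσ'] at this
      exact_mod_cast this
    exact hCT.trans (le_mul_of_one_le_right (Nat.cast_nonneg C) h1)

/-- The crux of route RuelleBand implies its own barrier statements: with the tree's
`RiemannHypothesis → crux` (`bandSet_eq_empty_of_riemannHypothesis`) the crux is sandwiched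
`RH ⟹ crux ⟹ DH` unconditionally and `crux ⟹ LH` modulo Titchmarsh 13.5. [folklore] -/
theorem acl_sandwich :
    (RiemannHypothesis → AsymptoticCriticalLine) ∧ (AsymptoticCriticalLine → DensityHypothesis) ∧
      (Titchmarsh1986_thm13_5 → AsymptoticCriticalLine → LindelofHypothesis) :=
  ⟨fun hRH => acl_iff_bandSet.2 fun ε hε => by
      rw [bandSet_eq_empty_of_riemannHypothesis hRH hε]; exact finite_empty,
    densityHypothesis_of_acl, lindelof_of_acl⟩

end Summit.RiemannHypothesis.RiemannHypothesis.Theorems.AsymptoticCriticalLine.Negative
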